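import Mathlib
import HarnessLib

/-!
# Route LiouvilleSarnak — support `AlignedTypeI` (stmt-ValiantsHypothesis-21040), line `characters_mod_2n`:
# from log-weighted prime sums to prime sums (discrete partial summation)

Glue towards the hypothesis (PCS) of `alignedTypeI_of_primeCharSums` (`…BilinearSieveAssembly.lean`): the literature
(Banks–Shparlinski 2019 Thm 2.2, `ψ(x,χ) = Σ_{n≤x} Λ(n)χ(n)`; after removing prime powers, `θ(x,χ) = Σ_{p≤x} (log p) χ(p)`)
bounds LOG-WEIGHTED prime sums, while (PCS) is about `Σ_{p ≤ u} χ(p)`.  This file is the def-free, measure-free bridge by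
DISCRETE partial summation (`Finset.sum_range_by_parts`), for arbitrary coefficients `c : ℕ → ℂ`:

* `inv_log_sub_inv_log_succ_le` — `1/log i − 1/log(i+1) ≤ 1/(i log² i)` (`i ≥ 2`);
* `norm_sum_primes_le_of_logWeighted` — if `‖Σ_{p ≤ t} (log p) c(p)‖ ≤ M t` for `t < u₀` and `≤ η t` for `u₀ ≤ t ≤ u`, then
  `‖Σ_{p ≤ u} c(p)‖ ≤ η u/log u + η Σ_{u₀ ≤ i < u} 1/log² i + M Σ_{2 ≤ i < u₀} 1/log² i`;
* `sum_Ico_inv_log_sq_le` — `Σ_{m ≤ i < u} 1/log² i ≤ (v − m)/log² m + (u − v)/log² v` for `2 ≤ m ≤ v ≤ u` (split at `v ≈ √u`).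

HONEST FRAMING. Bookkeeping only; `AlignedTypeI` is NOT closed here; nothing bears on `VP ≠ VNP` (NOT proved).
-/

set_option linter.dupNamespace false

noncomputable section

namespace Summit.ValiantsHypothesis.ValiantsHypothesis.Theorems.LiouvilleSarnak.AlignedTypeI.CharactersModTwoN

open Finset
open scoped BigOperators

/-- `1/log i − 1/log(i+1) ≤ 1/(i log² i)` for `i ≥ 2`. [folklore] -/
theorem inv_log_sub_inv_log_succ_le (i : ℕ) (hi : 2 ≤ i) :
    (Real.log i)⁻¹ - (Real.log (i + 1))⁻¹ ≤ 1 / ((i : ℝ) * Real.log i ^ 2) := by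
  have hiR : (2 : ℝ) ≤ i := by exact_mod_cast hi
  have hli : 0 < Real.log i := Real.log_pos (by linarith)
  have hli1 : Real.log i ≤ Real.log (i + 1) := Real.log_le_log (by linarith) (by linarith)
  have hli1' : 0 < Real.log (i + 1) := lt_of_lt_of_le hli hli1
  have hdiff : Real.log (i + 1) - Real.log i ≤ 1 / i := by
    rw [← Real.log_div (by linarith) (by linarith)]
    have h : Real.log (((i : ℝ) + 1) / i) ≤ ((i : ℝ) + 1) / i - 1 := Real.log_le_sub_one_of_pos (by positivity)
    have h2 : ((i : ℝ) + 1) / i - 1 = 1 / i := by field_simp; ring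
    linarith
  rw [inv_sub_inv hli.ne' hli1'.ne', div_le_div_iff₀ (by positivity) (by positivity)]
  calc (Real.log (↑i + 1) - Real.log ↑i) * (↑i * Real.log ↑i ^ 2)
      ≤ (1 / i) * (↑i * Real.log ↑i ^ 2) := by gcongr
    _ = Real.log i * Real.log i := by field_simp
    _ ≤ 1 * (Real.log ↑i * Real.log (↑i + 1)) := by rw [one_mul]; gcongr

/-- `(0, t]`-prime sums written over `range (t+1)`. [folklore] -/
theorem sum_range_succ_ite_prime_eq {M : Type*} [AddCommMonoid M] (g : ℕ → M) (t : ℕ) :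
    ∑ i ∈ Finset.range (t + 1), (if i.Prime then g i else 0) = ∑ p ∈ (Finset.Iic t).filter Nat.Prime, g p := by
  rw [Nat.range_succ_eq_Iic, Finset.sum_filter]

/-- **Prime sums from log-weighted prime sums (discrete partial summation).**  For `c : ℕ → ℂ`, `2 ≤ u₀ ≤ u`, `η, M ≥ 0`:
if `‖Σ_{p ≤ t} (log p) c(p)‖ ≤ M t` for `t < u₀` and `≤ η t` for `u₀ ≤ t ≤ u`, then
`‖Σ_{p ≤ u} c(p)‖ ≤ η u / log u + η Σ_{u₀ ≤ i < u} 1/log² i + M Σ_{2 ≤ i < u₀} 1/log² i`. [folklore] -/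
theorem norm_sum_primes_le_of_logWeighted (c : ℕ → ℂ) {η M : ℝ} (hη : 0 ≤ η) (hM : 0 ≤ M)
    {u₀ u : ℕ} (hu₀ : 2 ≤ u₀) (hu : u₀ ≤ u)
    (hA₀ : ∀ t : ℕ, t < u₀ → ‖∑ p ∈ (Finset.Iic t).filter Nat.Prime, (Real.log p : ℂ) * c p‖ ≤ M * t)
    (hA : ∀ t : ℕ, u₀ ≤ t → t ≤ u → ‖∑ p ∈ (Finset.Iic t).filter Nat.Prime, (Real.log p : ℂ) * c p‖ ≤ η * t) :
    ‖∑ p ∈ (Finset.Iic u).filter Nat.Prime, c p‖ ≤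
      η * u / Real.log u + η * ∑ i ∈ Finset.Ico u₀ u, 1 / Real.log i ^ 2 +
        M * ∑ i ∈ Finset.Ico 2 u₀, 1 / Real.log i ^ 2 := by
  classical
  -- partial summation data
  set f : ℕ → ℂ := fun i => ((Real.log i)⁻¹ : ℝ) with hf
  set g : ℕ → ℂ := fun i => if i.Prime then (Real.log i : ℂ) * c i else 0 with hg
  set T : ℕ → ℂ := fun t => ∑ p ∈ (Finset.Iic t).filter Nat.Prime, (Real.log p : ℂ) * c p with hT
  have hG : ∀ t, ∑ i ∈ Finset.range (t + 1), g i = T t := fun t => sum_range_succ_ite_prime_eq _ t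
  -- the target sum as `Σ f i • g i`
  have hfg : ∀ i, f i • g i = if i.Prime then c i else 0 := by
    intro i
    rw [hf, hg, smul_eq_mul]
    simp only
    split_ifs with hp
    · have hli : Real.log i ≠ 0 := by
        have : (2 : ℝ) ≤ i := by exact_mod_cast hp.two_le
        exact (Real.log_pos (by linarith)).ne'
      rw [← mul_assoc, ← Complex.ofReal_mul, inv_mul_cancel₀ hli, Complex.ofReal_one, one_mul]
    · rw [mul_zero]
  have hLHS : ∑ p ∈ (Finset.Iic u).filter Nat.Prime, c p = ∑ i ∈ Finset.range (u + 1), f i • g i := by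
    simp_rw [hfg]
    exact (sum_range_succ_ite_prime_eq c u).symm
  have hparts := Finset.sum_range_by_parts f g (u + 1)
  simp only [Nat.add_sub_cancel] at hparts
  rw [hLHS, hparts, hG u]
  -- `G (i+1) = T i`
  simp_rw [hG]
  -- norms
  have hu2 : (2 : ℝ) ≤ u := by exact_mod_cast hu₀.trans hu
  have hlu : 0 < Real.log u := Real.log_pos (by linarith)
  have hfu : ‖f u‖ = (Real.log u)⁻¹ := by
    rw [hf]
    simp only
    rw [Complex.norm_real, Real.norm_eq_abs, abs_of_pos (inv_pos.mpr hlu)]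
  have h1 : ‖f u • T u‖ ≤ η * u / Real.log u := by
    rw [norm_smul, hfu, hT]
    calc (Real.log ↑u)⁻¹ * ‖∑ p ∈ (Finset.Iic u).filter Nat.Prime, (Real.log p : ℂ) * c p‖
        ≤ (Real.log ↑u)⁻¹ * (η * u) := mul_le_mul_of_nonneg_left (hA u hu le_rfl) (inv_pos.mpr hlu).le
      _ = η * u / Real.log u := by rw [inv_mul_eq_div]
  -- the difference terms
  have hdiff : ∀ i ∈ Finset.range u, ‖(f (i + 1) - f i) • T i‖ ≤
      (if i < u₀ then M else η) * (if 2 ≤ i then 1 / Real.log i ^ 2 else 0) := by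
    intro i hi
    rw [Finset.mem_range] at hi
    by_cases h2 : 2 ≤ i
    · rw [if_pos h2]
      have hiR : (2 : ℝ) ≤ i := by exact_mod_cast h2
      have hli : 0 < Real.log i := Real.log_pos (by linarith)
      have hkey := inv_log_sub_inv_log_succ_le i h2
      have hnn : 0 ≤ (Real.log i)⁻¹ - (Real.log (i + 1))⁻¹ := by
        rw [sub_nonneg]
        exact inv_anti₀ hli (Real.log_le_log (by linarith) (by linarith))
      have hnormf : ‖f (i + 1) - f i‖ = (Real.log i)⁻¹ - (Real.log (i + 1))⁻¹ := by
        have hfi : f (i + 1) - f i = (((Real.log ((i : ℝ) + 1))⁻¹ - (Real.log (i : ℝ))⁻¹ : ℝ) : ℂ) := by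
          rw [hf]
          simp only [Nat.cast_succ, Complex.ofReal_sub]
        rw [hfi, Complex.norm_real, Real.norm_eq_abs, abs_sub_comm, abs_of_nonneg hnn]
      rw [norm_smul, hnormf]
      have hTi : ‖T i‖ ≤ (if i < u₀ then M else η) * i := by
        split_ifs with h
        · exact hA₀ i h
        · exact hA i (not_lt.mp h) hi.le
      have hc0 : 0 ≤ (if i < u₀ then M else η) := by split_ifs <;> assumption
      calc ((Real.log ↑i)⁻¹ - (Real.log (↑i + 1))⁻¹) * ‖T i‖
          ≤ (1 / ((i : ℝ) * Real.log i ^ 2)) * ((if i < u₀ then M else η) * i) :=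
            mul_le_mul hkey hTi (norm_nonneg _) (by positivity)
        _ = (if i < u₀ then M else η) * (1 / Real.log ↑i ^ 2) := by field_simp
    · rw [if_neg h2, mul_zero]
      -- `i ∈ {0, 1}`: `T i = 0`
      have hT0 : T i = 0 := by
        rw [hT]
        refine Finset.sum_eq_zero fun p hp => ?_
        simp only [Finset.mem_filter, Finset.mem_Iic] at hp
        exact absurd (hp.2.two_le.trans hp.1) (by omega)
      rw [hT0, smul_zero, norm_zero]
  -- assemble
  calc ‖f u • T u - ∑ i ∈ Finset.range u, (f (i + 1) - f i) • T i‖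
      ≤ ‖f u • T u‖ + ‖∑ i ∈ Finset.range u, (f (i + 1) - f i) • T i‖ := norm_sub_le _ _
    _ ≤ η * u / Real.log u + ∑ i ∈ Finset.range u, ‖(f (i + 1) - f i) • T i‖ := by
        gcongr
        exact norm_sum_le _ _
    _ ≤ η * u / Real.log u +
          ∑ i ∈ Finset.range u, (if i < u₀ then M else η) * (if 2 ≤ i then 1 / Real.log i ^ 2 else 0) := by
        gcongr with i hi
        exact hdiff i hi
    _ = η * u / Real.log u + (M * ∑ i ∈ Finset.Ico 2 u₀, 1 / Real.log i ^ 2 +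
          η * ∑ i ∈ Finset.Ico u₀ u, 1 / Real.log i ^ 2) := by
        congr 1
        -- split `range u = Ico 0 u₀ ∪ Ico u₀ u`, and `Ico 0 u₀ ⊇ Ico 2 u₀` with vanishing terms below `2`
        rw [Finset.range_eq_Ico, ← Finset.sum_Ico_consecutive _ (Nat.zero_le u₀) hu]
        congr 1
        · rw [← Finset.sum_Ico_consecutive _ (show 0 ≤ 2 by norm_num) hu₀, Finset.mul_sum]
          have hz : ∑ i ∈ Finset.Ico 0 2, (if i < u₀ then M else η) * (if 2 ≤ i then 1 / Real.log (i : ℝ) ^ 2 else 0) = 0 :=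
            Finset.sum_eq_zero fun i hi => by
              rw [Finset.mem_Ico] at hi
              rw [if_neg (show ¬ (2 ≤ i) by omega), mul_zero]
          rw [hz, zero_add]
          refine Finset.sum_congr rfl fun i hi => ?_
          rw [Finset.mem_Ico] at hi
          rw [if_pos hi.2, if_pos hi.1]
        · rw [Finset.mul_sum]
          refine Finset.sum_congr rfl fun i hi => ?_
          rw [Finset.mem_Ico] at hi
          rw [if_neg (not_lt.mpr hi.1), if_pos (hu₀.trans hi.1)]
    _ = _ := by ring

/-- Splitting bound for `Σ 1/log²`: for `2 ≤ m ≤ v ≤ u`,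
`Σ_{m ≤ i < u} 1/log² i ≤ (v − m)/log² m + (u − v)/log² v`. [folklore] -/
theorem sum_Ico_inv_log_sq_le {m v u : ℕ} (hm : 2 ≤ m) (hmv : m ≤ v) (hvu : v ≤ u) :
    ∑ i ∈ Finset.Ico m u, 1 / Real.log i ^ 2 ≤
      ((v : ℝ) - m) / Real.log m ^ 2 + ((u : ℝ) - v) / Real.log v ^ 2 := by
  have hmR : (2 : ℝ) ≤ m := by exact_mod_cast hm
  have hlm : 0 < Real.log m := Real.log_pos (by linarith)
  have hblock : ∀ a b : ℕ, m ≤ a → a ≤ b →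
      ∑ i ∈ Finset.Ico a b, 1 / Real.log i ^ 2 ≤ ((b : ℝ) - a) / Real.log a ^ 2 := by
    intro a b ha hab
    have haR : (2 : ℝ) ≤ a := by exact_mod_cast hm.trans ha
    have hla : 0 < Real.log a := Real.log_pos (by linarith)
    calc ∑ i ∈ Finset.Ico a b, 1 / Real.log i ^ 2 ≤ ∑ i ∈ Finset.Ico a b, 1 / Real.log a ^ 2 := by
          refine Finset.sum_le_sum fun i hi => ?_
          rw [Finset.mem_Ico] at hi
          have : Real.log a ≤ Real.log i := Real.log_le_log (by linarith) (by exact_mod_cast hi.1)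
          gcongr
      _ = ((b : ℝ) - a) / Real.log a ^ 2 := by
          rw [Finset.sum_const, Nat.card_Ico, nsmul_eq_mul, Nat.cast_sub hab]
          ring
  rw [← Finset.sum_Ico_consecutive _ hmv hvu]
  exact add_le_add (hblock m v le_rfl hmv) (hblock v u hmv hvu)

end Summit.ValiantsHypothesis.ValiantsHypothesis.Theorems.LiouvilleSarnak.AlignedTypeI.CharactersModTwoN
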